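import Summits.Ventures.QEDPrecision.Integrands.DeltaM4bExact

/-!
# The two table integrals of the `ΔM₄_b = −3/16` derivation, proved
(venture QEDPrecision, cell `pub-qed`, integrand seat int-1, gen 12)

HONEST FRAMING (verbatim, venture QEDPrecision): independent recomputation; certified where stated,
statistical where stated; no new-physics claim.

`Integrands/DeltaM4bExact.lean` proves `ΔM₄_b = −3/16` from two named hypotheses. This file
DISCHARGES the elementary one, `TableIntegrals`:
`∫₀¹ (log(1−u)/u² + 1/u) du = −1` and `∫₀¹ (log(1−u)/u³ + 1/u² + 1/(2u)) du = −3/4` together with the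
interval-integrability of both regularised integrands on `[0,1]` — by the fundamental theorem of
calculus with the continuous extensions of the antiderivatives `−(1−u) log(1−u)/u` (value `1` at
`u = 0`) and `−((1−u²) log(1−u) + u)/(2u²)` (value `1/4` at `u = 0`), the endpoint behaviour being
controlled by the Taylor remainder bound `Real.abs_log_sub_add_sum_range_le`. Consequently
(`deltaM4b_eq_of_layers012`) the ONLY remaining hypothesis behind `ΔM₄_b = −3/16` is
`Layers012Hypothesis` — layers 0–2 of the memo (exact computer algebra, not Lean; derived, not
certified).
-/

namespace Summit.Ventures.QEDPrecision.Integrands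

open Real MeasureTheory intervalIntegral Set Filter
open scoped Interval Topology

/-! ## Taylor-remainder bounds for `log (1 − u)` on `(0, 1/2]` -/

/-- First-order Taylor remainder: `|log(1−u) + u| ≤ 2u²` for `0 < u ≤ 1/2`. -/
theorem abs_log_one_sub_add_le (u : ℝ) (hu0 : 0 < u) (hu : u ≤ 1 / 2) :
    |log (1 - u) + u| ≤ 2 * u ^ 2 := by
  have habs : |u| = u := abs_of_pos hu0
  have h1 : |u| < 1 := by rw [habs]; linarith
  have h := Real.abs_log_sub_add_sum_range_le h1 1
  simp only [Finset.sum_range_one, habs] at h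
  norm_num at h
  have hden : u ^ 2 / (1 - u) ≤ 2 * u ^ 2 := by
    rw [div_le_iff₀ (by linarith)]
    nlinarith [sq_nonneg u]
  calc |log (1 - u) + u| = |u + log (1 - u)| := by rw [add_comm]
    _ ≤ u ^ 2 / (1 - u) := h
    _ ≤ 2 * u ^ 2 := hden

/-- Second-order Taylor remainder: `|log(1−u) + u + u²/2| ≤ 2u³` for `0 < u ≤ 1/2`. -/
theorem abs_log_one_sub_add_add_le (u : ℝ) (hu0 : 0 < u) (hu : u ≤ 1 / 2) :
    |log (1 - u) + u + u ^ 2 / 2| ≤ 2 * u ^ 3 := by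
  have habs : |u| = u := abs_of_pos hu0
  have h1 : |u| < 1 := by rw [habs]; linarith
  have h := Real.abs_log_sub_add_sum_range_le h1 2
  simp only [Finset.sum_range_succ, Finset.sum_range_zero, habs] at h
  norm_num at h
  have hden : u ^ 3 / (1 - u) ≤ 2 * u ^ 3 := by
    rw [div_le_iff₀ (by linarith)]
    nlinarith [pow_pos hu0 3]
  calc |log (1 - u) + u + u ^ 2 / 2| = |u + u ^ 2 / 2 + log (1 - u)| := by ring_nf
    _ ≤ u ^ 3 / (1 - u) := h
    _ ≤ 2 * u ^ 3 := hden

/-! ## Interval-integrability of the two regularised integrands on `[0, 1]` -/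

/-- `reg2` is measurable. -/
private theorem measurable_reg2 : Measurable reg2 := by
  unfold reg2
  fun_prop

/-- `reg3` is measurable. -/
private theorem measurable_reg3 : Measurable reg3 := by
  unfold reg3
  fun_prop

/-- On `(0, 1/2]` the integrand `reg2` is bounded by `2`. -/
theorem abs_reg2_le (u : ℝ) (hu0 : 0 < u) (hu : u ≤ 1 / 2) : |reg2 u| ≤ 2 := by
  have hu0' : u ≠ 0 := ne_of_gt hu0
  have e : reg2 u = (log (1 - u) + u) / u ^ 2 := by
    unfold reg2
    field_simp
  rw [e, abs_div, abs_of_pos (pow_pos hu0 2), div_le_iff₀ (pow_pos hu0 2)]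
  exact abs_log_one_sub_add_le u hu0 hu

/-- On `(0, 1/2]` the integrand `reg3` is bounded by `2`. -/
theorem abs_reg3_le (u : ℝ) (hu0 : 0 < u) (hu : u ≤ 1 / 2) : |reg3 u| ≤ 2 := by
  have hu0' : u ≠ 0 := ne_of_gt hu0
  have e : reg3 u = (log (1 - u) + u + u ^ 2 / 2) / u ^ 3 := by
    unfold reg3
    field_simp
  rw [e, abs_div, abs_of_pos (pow_pos hu0 3), div_le_iff₀ (pow_pos hu0 3)]
  calc |log (1 - u) + u + u ^ 2 / 2| ≤ 2 * u ^ 3 := abs_log_one_sub_add_add_le u hu0 hu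
    _ = 2 * u ^ 3 := rfl

/-- A measurable function bounded on `(0, 1/2]` is interval-integrable on `[0, 1/2]`. -/
private theorem intervalIntegrable_of_bound_Ioc {f : ℝ → ℝ} (hf : Measurable f) (C : ℝ)
    (hC : ∀ u, 0 < u → u ≤ 1 / 2 → |f u| ≤ C) : IntervalIntegrable f volume 0 (1 / 2) := by
  rw [intervalIntegrable_iff_integrableOn_Ioc_of_le (by norm_num : (0:ℝ) ≤ 1 / 2)]
  refine Measure.integrableOn_of_bounded (M := C) (by simp) hf.aestronglyMeasurable ?_
  rw [ae_restrict_iff' measurableSet_Ioc]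
  exact Filter.Eventually.of_forall (fun u hu => by simpa [Real.norm_eq_abs] using hC u hu.1 hu.2)

/-- `u ↦ log (1 − u)` is interval-integrable on every interval. -/
private theorem log_one_sub_intervalIntegrable (a b : ℝ) :
    IntervalIntegrable (fun u : ℝ => log (1 - u)) volume a b := by
  have := (intervalIntegral.intervalIntegrable_log' (a := 1 - a) (b := 1 - b)).comp_sub_left 1
  simp only [sub_sub_cancel] at this
  exact this

/-- `reg2 = log(1−u)/u² + 1/u` is interval-integrable on `[0, 1]` (bounded near `0`, a logarithmic
singularity at `1`). -/
theorem reg2_intervalIntegrable : IntervalIntegrable reg2 volume 0 1 := by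
  have h1 : IntervalIntegrable reg2 volume 0 (1 / 2) :=
    intervalIntegrable_of_bound_Ioc measurable_reg2 2 abs_reg2_le
  have h2 : IntervalIntegrable reg2 volume (1 / 2) 1 := by
    have hc1 : ContinuousOn (fun u : ℝ => 1 / u ^ 2) (uIcc (1 / 2 : ℝ) 1) := by
      apply ContinuousOn.div continuousOn_const (by fun_prop)
      intro u hu
      rw [uIcc_of_le (by norm_num : (1 / 2 : ℝ) ≤ 1)] at hu
      exact pow_ne_zero 2 (by linarith [hu.1])
    have hc2 : ContinuousOn (fun u : ℝ => 1 / u) (uIcc (1 / 2 : ℝ) 1) := by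
      apply ContinuousOn.div continuousOn_const (by fun_prop)
      intro u hu
      rw [uIcc_of_le (by norm_num : (1 / 2 : ℝ) ≤ 1)] at hu
      linarith [hu.1]
    have h := ((log_one_sub_intervalIntegrable (1 / 2) 1).mul_continuousOn hc1).add
      hc2.intervalIntegrable
    have e : reg2 = fun x => log (1 - x) * (1 / x ^ 2) + 1 / x := by
      funext x; unfold reg2; ring
    rw [e]
    exact h
  exact h1.trans h2

/-- `reg3 = log(1−u)/u³ + 1/u² + 1/(2u)` is interval-integrable on `[0, 1]`. -/
theorem reg3_intervalIntegrable : IntervalIntegrable reg3 volume 0 1 := by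
  have h1 : IntervalIntegrable reg3 volume 0 (1 / 2) :=
    intervalIntegrable_of_bound_Ioc measurable_reg3 2 abs_reg3_le
  have h2 : IntervalIntegrable reg3 volume (1 / 2) 1 := by
    have hc1 : ContinuousOn (fun u : ℝ => 1 / u ^ 3) (uIcc (1 / 2 : ℝ) 1) := by
      apply ContinuousOn.div continuousOn_const (by fun_prop)
      intro u hu
      rw [uIcc_of_le (by norm_num : (1 / 2 : ℝ) ≤ 1)] at hu
      exact pow_ne_zero 3 (by linarith [hu.1])
    have hc2 : ContinuousOn (fun u : ℝ => 1 / u ^ 2 + 1 / (2 * u)) (uIcc (1 / 2 : ℝ) 1) := by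
      rw [uIcc_of_le (by norm_num : (1 / 2 : ℝ) ≤ 1)]
      apply ContinuousOn.add
      · apply ContinuousOn.div continuousOn_const (by fun_prop)
        intro u hu
        exact pow_ne_zero 2 (by linarith [hu.1])
      · apply ContinuousOn.div continuousOn_const (by fun_prop)
        intro u hu
        have : 0 < u := by linarith [hu.1]
        positivity
    have h := ((log_one_sub_intervalIntegrable (1 / 2) 1).mul_continuousOn hc1).add
      hc2.intervalIntegrable
    have e : reg3 = fun x => log (1 - x) * (1 / x ^ 3) + (1 / x ^ 2 + 1 / (2 * x)) := by
      funext x; unfold reg3; ring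
    rw [e]
    exact h
  exact h1.trans h2

/-! ## The antiderivatives, continuously extended to `u = 0`, and the two values -/

/-- A right-limit at `0` from a linear bound on `(0, 1/2]`. -/
private theorem tendsto_right_of_bound {f : ℝ → ℝ} {b : ℝ} (K : ℝ) (hK : 0 < K)
    (h : ∀ u, 0 < u → u ≤ 1 / 2 → |f u - b| ≤ K * u) :
    Tendsto f (𝓝[Icc 0 1 \ {0}] 0) (𝓝 b) := by
  rw [Metric.tendsto_nhdsWithin_nhds]
  intro ε hε
  refine ⟨min (1 / 2) (ε / (2 * K)), by positivity, ?_⟩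
  intro x hx hdist
  have hx0' : x ≠ 0 := by simpa using hx.2
  have hx0 : 0 < x := lt_of_le_of_ne hx.1.1 (Ne.symm hx0')
  rw [Real.dist_eq, sub_zero, abs_of_pos hx0] at hdist
  have hx12 : x ≤ 1 / 2 := le_of_lt (lt_of_lt_of_le hdist (min_le_left _ _))
  have hxe : x < ε / (2 * K) := lt_of_lt_of_le hdist (min_le_right _ _)
  have hKx : K * x < ε / 2 := by
    have := mul_lt_mul_of_pos_left hxe hK
    calc K * x < K * (ε / (2 * K)) := this
      _ = ε / 2 := by field_simp
  rw [Real.dist_eq]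
  calc |f x - b| ≤ K * x := h x hx0 hx12
    _ < ε := by linarith

/-- Antiderivative of `reg2`, `−(1−u) log(1−u)/u`, extended by its limit `1` at `u = 0`. -/
noncomputable def G2 (u : ℝ) : ℝ := if u = 0 then 1 else -((1 - u) * log (1 - u)) / u

/-- `G2' = reg2` on `(0, 1)`. -/
theorem hasDerivAt_G2 (u : ℝ) (hu0 : 0 < u) (hu1 : u < 1) : HasDerivAt G2 (reg2 u) u := by
  have hu0' : u ≠ 0 := ne_of_gt hu0
  have h1u : (1 : ℝ) - u ≠ 0 := ne_of_gt (sub_pos.mpr hu1)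
  have hlin : HasDerivAt (fun x : ℝ => 1 - x) (-1) u := by
    simpa using (hasDerivAt_id' u).const_sub 1
  have hlog : HasDerivAt (fun x : ℝ => log (1 - x)) ((-1) / (1 - u)) u := hlin.log h1u
  have hdiv := ((hlin.mul hlog).neg).div (hasDerivAt_id' u) hu0'
  have hG : G2 =ᶠ[𝓝 u] (fun x : ℝ => -((1 - x) * log (1 - x)) / x) := by
    filter_upwards [isOpen_ne.mem_nhds hu0'] with x hx
    simp only [G2, if_neg hx]
  refine (hdiv.congr_of_eventuallyEq hG).congr_deriv ?_
  simp only [Pi.neg_apply, Pi.mul_apply]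
  unfold reg2
  field_simp
  ring

/-- `G2` is continuous on `[0, 1]` (the value `1` at `0` is the right limit). -/
theorem continuousOn_G2 : ContinuousOn G2 (Icc 0 1) := by
  intro u hu
  by_cases hu0 : u = 0
  · subst hu0
    rw [← continuousWithinAt_sdiff_self, ContinuousWithinAt]
    have hG0 : G2 0 = 1 := by simp [G2]
    rw [hG0]
    have heq : ∀ᶠ x in 𝓝[Icc 0 1 \ {0}] (0:ℝ), -((1 - x) * log (1 - x)) / x = G2 x := by
      filter_upwards [self_mem_nhdsWithin] with x hx
      have hx0 : x ≠ 0 := by simpa using hx.2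
      simp only [G2, if_neg hx0]
    refine Tendsto.congr' heq (tendsto_right_of_bound 3 (by norm_num) ?_)
    intro x hx0 hx12
    have hx0' : x ≠ 0 := ne_of_gt hx0
    have hb := abs_log_one_sub_add_le x hx0 hx12
    have e : -((1 - x) * log (1 - x)) / x - 1 = -((log (1 - x) + x) * (1 - x) + x ^ 2) / x := by
      field_simp
      ring
    rw [e, abs_div, abs_of_pos hx0, div_le_iff₀ hx0, abs_neg]
    have h1x : 0 ≤ 1 - x := by linarith
    calc |(log (1 - x) + x) * (1 - x) + x ^ 2|
        ≤ |(log (1 - x) + x) * (1 - x)| + |x ^ 2| := abs_add_le _ _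
      _ = |log (1 - x) + x| * (1 - x) + x ^ 2 := by
          rw [abs_mul, abs_of_nonneg h1x, abs_of_nonneg (sq_nonneg x)]
      _ ≤ 2 * x ^ 2 * (1 - x) + x ^ 2 := by
          have := mul_le_mul_of_nonneg_right hb h1x
          linarith
      _ ≤ 3 * x * x := by nlinarith [sq_nonneg x, hx0]
  · have hcont : ContinuousAt (fun x : ℝ => -((1 - x) * log (1 - x)) / x) u := by
      have h1 : Continuous fun x : ℝ => (1 - x) * log (1 - x) :=
        Real.continuous_mul_log.comp (continuous_const.sub continuous_id)
      exact (h1.neg.continuousAt).div continuousAt_id hu0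
    have heq : (fun x : ℝ => -((1 - x) * log (1 - x)) / x) =ᶠ[𝓝 u] G2 := by
      filter_upwards [isOpen_ne.mem_nhds hu0] with x hx
      simp only [G2, if_neg hx]
    exact (hcont.congr heq).continuousWithinAt

/-- `∫₀¹ (log(1−u)/u² + 1/u) du = −1`. -/
theorem integral_reg2 : (∫ u in (0:ℝ)..1, reg2 u) = -1 := by
  rw [intervalIntegral.integral_eq_sub_of_hasDerivAt_of_le zero_le_one continuousOn_G2
    (fun u hu => hasDerivAt_G2 u hu.1 hu.2) reg2_intervalIntegrable]
  norm_num [G2]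

/-- Antiderivative of `reg3`, `−((1−u²) log(1−u) + u)/(2u²)`, extended by its limit `1/4` at `u = 0`. -/
noncomputable def G3 (u : ℝ) : ℝ :=
  if u = 0 then 1 / 4 else -((1 - u ^ 2) * log (1 - u) + u) / (2 * u ^ 2)

/-- `G3' = reg3` on `(0, 1)`. -/
theorem hasDerivAt_G3 (u : ℝ) (hu0 : 0 < u) (hu1 : u < 1) : HasDerivAt G3 (reg3 u) u := by
  have hu0' : u ≠ 0 := ne_of_gt hu0
  have h1u : (1 : ℝ) - u ≠ 0 := ne_of_gt (sub_pos.mpr hu1)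
  have hlin : HasDerivAt (fun x : ℝ => 1 - x) (-1) u := by
    simpa using (hasDerivAt_id' u).const_sub 1
  have hlog : HasDerivAt (fun x : ℝ => log (1 - x)) ((-1) / (1 - u)) u := hlin.log h1u
  have hxx : HasDerivAt (fun x : ℝ => x * x) (1 * u + u * 1) u :=
    (hasDerivAt_id' u).mul (hasDerivAt_id' u)
  have hsq : HasDerivAt (fun x : ℝ => 1 - x * x) (-(1 * u + u * 1)) u := hxx.const_sub 1
  have hN : HasDerivAt (fun x : ℝ => (1 - x * x) * log (1 - x) + x)
      (-(1 * u + u * 1) * log (1 - u) + (1 - u * u) * ((-1) / (1 - u)) + 1) u :=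
    (hsq.mul hlog).add (hasDerivAt_id' u)
  have hD : HasDerivAt (fun x : ℝ => 2 * (x * x)) (2 * (1 * u + u * 1)) u := hxx.const_mul 2
  have hdiv := (hN.neg).div hD (by positivity : (2 : ℝ) * (u * u) ≠ 0)
  have hG : G3 =ᶠ[𝓝 u] (fun x : ℝ => -((1 - x * x) * log (1 - x) + x) / (2 * (x * x))) := by
    filter_upwards [isOpen_ne.mem_nhds hu0'] with x hx
    simp only [G3, if_neg hx]
    ring
  refine (hdiv.congr_of_eventuallyEq hG).congr_deriv ?_
  simp only [Pi.neg_apply]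
  unfold reg3
  field_simp
  ring

/-- `G3` is continuous on `[0, 1]` (the value `1/4` at `0` is the right limit). -/
theorem continuousOn_G3 : ContinuousOn G3 (Icc 0 1) := by
  intro u hu
  by_cases hu0 : u = 0
  · subst hu0
    rw [← continuousWithinAt_sdiff_self, ContinuousWithinAt]
    have hG0 : G3 0 = 1 / 4 := by simp [G3]
    rw [hG0]
    have heq : ∀ᶠ x in 𝓝[Icc 0 1 \ {0}] (0:ℝ),
        -((1 - x ^ 2) * log (1 - x) + x) / (2 * x ^ 2) = G3 x := by
      filter_upwards [self_mem_nhdsWithin] with x hx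
      have hx0 : x ≠ 0 := by simpa using hx.2
      simp only [G3, if_neg hx0]
    refine Tendsto.congr' heq (tendsto_right_of_bound 2 (by norm_num) ?_)
    intro x hx0 hx12
    have hx0' : x ≠ 0 := ne_of_gt hx0
    have h2x : (0 : ℝ) < 2 * x ^ 2 := by positivity
    have hb := abs_log_one_sub_add_add_le x hx0 hx12
    have e : -((1 - x ^ 2) * log (1 - x) + x) / (2 * x ^ 2) - 1 / 4 =
        (-(log (1 - x) + x + x ^ 2 / 2) * (1 - x ^ 2) - x ^ 3 - x ^ 4 / 2) / (2 * x ^ 2) := by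
      field_simp
      ring
    rw [e, abs_div, abs_of_pos h2x, div_le_iff₀ h2x]
    have h1x2 : 0 ≤ 1 - x ^ 2 := by nlinarith
    obtain ⟨hlo, hhi⟩ := abs_le.mp hb
    have hlo' := mul_le_mul_of_nonneg_right hlo h1x2
    have hhi' := mul_le_mul_of_nonneg_right hhi h1x2
    have hx3 : 0 < x ^ 3 := pow_pos hx0 3
    have hx4 : 0 < x ^ 4 := pow_pos hx0 4
    have hx5 : 0 < x ^ 5 := pow_pos hx0 5
    rw [abs_le]
    constructor <;> nlinarith
  · have hcont : ContinuousAt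
        (fun x : ℝ => -((1 + x) * ((1 - x) * log (1 - x)) + x) / (2 * x ^ 2)) u := by
      have h1 : Continuous fun x : ℝ => (1 - x) * log (1 - x) :=
        Real.continuous_mul_log.comp (continuous_const.sub continuous_id)
      have h2 : Continuous fun x : ℝ => -((1 + x) * ((1 - x) * log (1 - x)) + x) :=
        (((continuous_const.add continuous_id).mul h1).add continuous_id).neg
      exact h2.continuousAt.div (by fun_prop) (by positivity)
    have heq : (fun x : ℝ => -((1 + x) * ((1 - x) * log (1 - x)) + x) / (2 * x ^ 2)) =ᶠ[𝓝 u] G3 := by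
      filter_upwards [isOpen_ne.mem_nhds hu0] with x hx
      simp only [G3, if_neg hx]
      ring
    exact (hcont.congr heq).continuousWithinAt

/-- `∫₀¹ (log(1−u)/u³ + 1/u² + 1/(2u)) du = −3/4`. -/
theorem integral_reg3 : (∫ u in (0:ℝ)..1, reg3 u) = -3 / 4 := by
  rw [intervalIntegral.integral_eq_sub_of_hasDerivAt_of_le zero_le_one continuousOn_G3
    (fun u hu => hasDerivAt_G3 u hu.1 hu.2) reg3_intervalIntegrable]
  norm_num [G3]

/-! ## Discharge of `TableIntegrals`; `ΔM₄_b = −3/16` from the layers-0–2 hypothesis alone -/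

/-- The named hypothesis `TableIntegrals` of `DeltaM4bExact` holds. -/
theorem tableIntegrals : TableIntegrals :=
  ⟨reg2_intervalIntegrable, integral_reg2, reg3_intervalIntegrable, integral_reg3⟩

/-- **ΔM₄_b = −3/16 from the layers-0–2 hypothesis alone**: if the AHKN-scheme amplitude `ΔM₄_b(abba)`
equals `∫₀¹ F2` with `F2` interval-integrable (int-1's exact computer algebra, memo DM4B-CLOSED-FORM
L0–L2 — derived, not certified, not kernel-checked), then it equals `−3/16`; everything downstream of
`F2` is now kernel-checked. -/
theorem deltaM4b_eq_of_layers012 (x : ℝ) (h : Layers012Hypothesis x) : x = deltaM4bClosedForm :=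
  deltaM4b_eq_of_hypotheses x h tableIntegrals

/-- The same with the value displayed. -/
theorem deltaM4b_eq_of_layers012' (x : ℝ) (h : Layers012Hypothesis x) : x = -3 / 16 := by
  have := deltaM4b_eq_of_layers012 x h
  unfold deltaM4bClosedForm at this
  exact this

end Summit.Ventures.QEDPrecision.Integrands
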